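import Summits.KontsevichZagierPeriods.KontsevichZagierPeriods.Theorems.HeckeMultiplicityOneManinStokesTileDecay
import Summits.KontsevichZagierPeriods.KontsevichZagierPeriods.Theorems.HeckeMultiplicityOneManinStokesTileRamanujan

/-!
# `ManinStokes` (stmt-KontsevichZagierPeriods-5277): the Jacobian integrand `‖j′‖·‖(ω/dj)′‖` at the cusp

Support file (prover-owned, `--supports stmt-KontsevichZagierPeriods-5277`). Cusp estimates for the change of
variables `u = j(z)`: `‖E₄‖, ‖E₆‖ ≤ 2`, `‖Δ‖ ≥ ‖q‖/2` and `‖J'(z)‖ ≤ 32π e^{2π im z}` for `im z ≥ 2`;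
`F = (ω/dj) ∘ ofComplex` is holomorphic on `im ≥ 2` with `‖F(w)‖ ≤ 16 C e^{−(2π/h) im w} e^{−2π im w}`, so by the
Cauchy estimate on discs of radius `1`, `‖F'(z)‖ ≤ C' e^{−(2π/h) im z} e^{−2π im z}` for `im z ≥ 3`, and
`‖J'(z)‖‖F'(z)‖ ≤ C″ e^{−(2π/h) im z}` there (`exists_norm_deriv_mul_le_cusp`).

References: J.-P. Serre, *A Course in Arithmetic* (1973), VII §4; M. Kontsevich, D. Zagier, *Periods* (2001),
§1.2. No definitions, no named facts.
-/

noncomputable section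

open scoped MatrixGroups ModularForm Modular Manifold Topology
open CongruenceSubgroup Complex Set Filter MeasureTheory ModularForm
open UpperHalfPlane hiding I
open Literature.NumberTheory.EllipticCurves Literature.NumberTheory.EllipticCurves.ModularForms

namespace Summit.KontsevichZagierPeriods.HeckeMultiplicityOne.ManinStokes

/-! ## The Jacobian integrand at the cusp

For `im z ≥ 3`: `‖J'(z)‖ ≤ 32π e^{2π im z}` (`J' = −2πi E₄²E₆/Δ` with `‖E₄‖, ‖E₆‖ ≤ 2`, `‖Δ‖ ≥ ‖q‖/2`) and, by
the Cauchy estimate on the disc of radius `1` (which stays in `im ≥ 2`),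
`‖F'(z)‖ ≤ 16 C e^{2π(1+1/h)} e^{−2π im z (1 + 1/h)}`; so `‖J'‖‖F'‖ ≤ C' e^{−2π im z/h}`. -/

section CuspBound

open Metric

/-- **`‖E₄(z)‖ ≤ 2` for `im z ≥ 2`.** [folklore] -/
theorem norm_E₄_le_of_two_le_im {z : ℍ} (hz : 2 ≤ z.im) : ‖E₄ z‖ ≤ 2 := by
  obtain ⟨-, hqle⟩ := norm_qParam_le_of_two_le_im hz
  set q := Function.Periodic.qParam 1 (z : ℂ) with hq
  set r := ‖q‖ with hr
  have hr0 : 0 ≤ r := norm_nonneg _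
  have h4 : ‖ModularForm.E₄ z - 1 - 240 * q‖ ≤ 61560 * r ^ 2 := norm_E₄_sub_sub_le z hqle
  have hid : ModularForm.E₄ z = (ModularForm.E₄ z - 1 - 240 * q) + 1 + 240 * q := by ring
  have h240 : ‖(240 : ℂ) * q‖ = 240 * r := by rw [norm_mul, hr]; norm_num
  change ‖ModularForm.E₄ z‖ ≤ 2
  rw [hid]
  calc ‖(ModularForm.E₄ z - 1 - 240 * q) + 1 + 240 * q‖
      ≤ ‖ModularForm.E₄ z - 1 - 240 * q‖ + ‖(1 : ℂ)‖ + ‖(240 : ℂ) * q‖ := norm_add₃_le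
    _ ≤ 61560 * r ^ 2 + 1 + 240 * r := by rw [norm_one, h240]; linarith
    _ ≤ 2 := by nlinarith

/-- **`‖E₆(z)‖ ≤ 2` for `im z ≥ 2`** (`E₆² = E₄³ − 1728Δ`). [folklore] -/
theorem norm_E₆_le_of_two_le_im {z : ℍ} (hz : 2 ≤ z.im) : ‖E₆ z‖ ≤ 2 := by
  have hΔ := norm_discriminant_le_of_two_le_im hz
  obtain ⟨-, hqle⟩ := norm_qParam_le_of_two_le_im hz
  obtain ⟨-, h43⟩ := norm_E₄_ge_of_two_le_im hz
  set r := ‖Function.Periodic.qParam 1 (z : ℂ)‖ with hr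
  have hr0 : 0 ≤ r := norm_nonneg _
  have hr1 : r ≤ 1 / 10 ^ 4 := hqle
  have hE6sq : ModularForm.E₆ z ^ 2 =
      (ModularForm.E₄ z ^ 3 - 1) + 1 - 1728 * ModularForm.discriminant z := by
    rw [ModularForm.discriminant_eq_E₄_cube_sub_E₆_sq]; ring
  have h1728 : ‖(1728 : ℂ) * ModularForm.discriminant z‖ ≤ 1728 * (2 * r) := by
    rw [norm_mul]; norm_num; linarith
  change ‖ModularForm.E₄ z ^ 3 - 1‖ ≤ 1 / 10 at h43
  have hsq : ‖ModularForm.E₆ z ^ 2‖ ≤ 4 := by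
    rw [hE6sq]
    calc ‖(ModularForm.E₄ z ^ 3 - 1) + 1 - 1728 * ModularForm.discriminant z‖
        ≤ ‖(ModularForm.E₄ z ^ 3 - 1) + 1‖ + ‖(1728 : ℂ) * ModularForm.discriminant z‖ := norm_sub_le _ _
      _ ≤ ‖ModularForm.E₄ z ^ 3 - 1‖ + ‖(1 : ℂ)‖ + ‖(1728 : ℂ) * ModularForm.discriminant z‖ := by
          gcongr; exact norm_add_le _ _
      _ ≤ 1 / 10 + 1 + 1728 * (2 * r) := by rw [norm_one]; linarith
      _ ≤ 4 := by nlinarith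
  rw [norm_pow] at hsq
  change ‖ModularForm.E₆ z‖ ≤ 2
  nlinarith [norm_nonneg (ModularForm.E₆ z)]

/-- **`‖Δ(z)‖ ≥ ‖q‖/2` for `im z ≥ 2`** (`Δ = q∏(1 − qⁿ)²⁴`, `‖(∏…)⁻¹‖ ≤ 1 + 24‖q‖ + 625‖q‖² ≤ 2`). [folklore] -/
theorem norm_discriminant_ge_of_two_le_im {z : ℍ} (hz : 2 ≤ z.im) :
    ‖Function.Periodic.qParam 1 (z : ℂ)‖ / 2 ≤ ‖ModularForm.discriminant z‖ := by
  obtain ⟨-, hqle⟩ := norm_qParam_le_of_two_le_im hz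
  set q := Function.Periodic.qParam 1 (z : ℂ) with hq
  set r := ‖q‖ with hr
  have hr0 : 0 ≤ r := norm_nonneg _
  set P := ∏' n : ℕ, (1 - q ^ (n + 1)) ^ 24 with hP
  have hΔ : ModularForm.discriminant z = q * P := ModularForm.discriminant_eq_q_prod z
  have hP0 : P ≠ 0 := by
    intro h0
    exact ModularForm.discriminant_ne_zero z (by rw [hΔ, h0, mul_zero])
  have h3 : ‖P⁻¹ - 1 - 24 * q‖ ≤ 625 * r ^ 2 := norm_inv_tprod_sub_sub_le hqle
  have h24 : ‖(24 : ℂ) * q‖ = 24 * r := by rw [norm_mul, hr]; norm_num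
  have hPinv : ‖P⁻¹‖ ≤ 2 := by
    have hid : P⁻¹ = (P⁻¹ - 1 - 24 * q) + 1 + 24 * q := by ring
    rw [hid]
    calc ‖P⁻¹ - 1 - 24 * q + 1 + 24 * q‖ ≤ ‖P⁻¹ - 1 - 24 * q‖ + ‖(1 : ℂ)‖ + ‖(24 : ℂ) * q‖ := norm_add₃_le
      _ ≤ 625 * r ^ 2 + 1 + 24 * r := by rw [norm_one, h24]; linarith
      _ ≤ 2 := by nlinarith
  have hPpos : 0 < ‖P‖ := norm_pos_iff.mpr hP0
  have hPge : 1 / 2 ≤ ‖P‖ := by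
    rw [norm_inv] at hPinv
    have h := mul_le_mul_of_nonneg_left hPinv hPpos.le
    rw [mul_inv_cancel₀ hPpos.ne'] at h
    linarith
  rw [hΔ, norm_mul, ← hr]
  nlinarith

/-- **`‖J'(z)‖ ≤ 32π e^{2π im z}` for `im z ≥ 2`** (`J' = −2πi E₄²E₆/Δ`). [folklore] -/
theorem norm_deriv_kleinJ_le_of_two_le_im {z : ℍ} (hz : 2 ≤ z.im) :
    ‖deriv (kleinJ ∘ ofComplex) z‖ ≤ 32 * Real.pi * Real.exp (2 * Real.pi * z.im) := by
  obtain ⟨hnq, -⟩ := norm_qParam_le_of_two_le_im hz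
  have hΔ := norm_discriminant_ge_of_two_le_im hz
  have h4 := norm_E₄_le_of_two_le_im hz
  have h6 := norm_E₆_le_of_two_le_im hz
  set r := ‖Function.Periodic.qParam 1 (z : ℂ)‖ with hr
  have hr0 : 0 < r := norm_pos_iff.mpr (Function.Periodic.qParam_ne_zero (z : ℂ))
  have hexp : Real.exp (2 * Real.pi * z.im) = r⁻¹ := by
    rw [hnq, Real.exp_neg, inv_inv]
  have hΔpos : 0 < ‖ModularForm.discriminant z‖ := norm_pos_iff.mpr (ModularForm.discriminant_ne_zero z)
  have h2π : ‖(2 * (Real.pi : ℂ) * I)‖ = 2 * Real.pi := by simp [abs_of_pos Real.pi_pos]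
  rw [deriv_kleinJ_comp_ofComplex, norm_mul, norm_neg, h2π, norm_div, norm_mul, norm_pow, hexp]
  change 2 * Real.pi * (‖E₄ z‖ ^ 2 * ‖E₆ z‖ / ‖ModularForm.discriminant z‖) ≤ 32 * Real.pi * r⁻¹
  rw [show 32 * Real.pi * r⁻¹ = 2 * Real.pi * (16 * r⁻¹) by ring]
  refine mul_le_mul_of_nonneg_left ?_ (by positivity)
  rw [div_le_iff₀ hΔpos]
  have h16 : ‖E₄ z‖ ^ 2 * ‖E₆ z‖ ≤ 8 := by nlinarith [norm_nonneg (E₄ z), norm_nonneg (E₆ z)]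
  have hr2 : 16 * r⁻¹ * ‖ModularForm.discriminant z‖ ≥ 16 * r⁻¹ * (r / 2) := by gcongr
  have : 16 * r⁻¹ * (r / 2) = 8 := by field_simp; ring
  linarith

variable {h : ℝ} {φ : ℍ → ℂ}

/-- `F = (ω/dj) ∘ ofComplex` is complex differentiable at points with `im ≥ 2` (no elliptic points
there: `‖E₄‖, ‖E₆‖ ≥ 1/2`). [folklore] -/
theorem differentiableAt_djQuot_of_two_le_im (hφ : MDifferentiable 𝓘(ℂ) 𝓘(ℂ) φ) {w : ℂ}
    (hw : 2 ≤ w.im) : DifferentiableAt ℂ (djQuot φ ∘ ofComplex) w := by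
  have hw0 : 0 < w.im := by linarith
  have hτ : 2 ≤ (⟨w, hw0⟩ : ℍ).im := hw
  have h4 : E₄ (⟨w, hw0⟩ : ℍ) ≠ 0 := fun h0 => by
    have := (norm_E₄_ge_of_two_le_im hτ).1
    rw [h0, norm_zero] at this
    linarith
  have h6 : E₆ (⟨w, hw0⟩ : ℍ) ≠ 0 := fun h0 => by
    have := norm_E₆_ge_of_two_le_im hτ
    rw [h0, norm_zero] at this
    linarith
  exact differentiableAt_djQuot_comp_ofComplex hφ h4 h6

/-- **`‖F(w)‖ ≤ 16 C e^{−(2π/h) im w} e^{−2π im w}` for `im w ≥ 2`** and a cusp function `φ` of period `h`.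
[folklore] -/
theorem exists_norm_djQuot_ofComplex_le (hφ : IsCuspFunction h φ) :
    ∃ C, 0 ≤ C ∧ ∀ w : ℂ, 2 ≤ w.im → ‖(djQuot φ ∘ ofComplex) w‖ ≤
      16 * C * Real.exp (-(2 * Real.pi / h) * w.im) * Real.exp (-(2 * Real.pi * w.im)) := by
  obtain ⟨C, hC0, hC⟩ := HaberlandStokes.exists_norm_apply_le hφ
  refine ⟨C, hC0, fun w hw => ?_⟩
  have hw0 : 0 < w.im := by linarith
  have hτ : ofComplex w = (⟨w, hw0⟩ : ℍ) := ofComplex_apply_of_im_pos hw0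
  have h1 := norm_djQuot_le_of_two_le_im φ (z := ⟨w, hw0⟩) hw
  have h2 := hC w (by linarith)
  rw [hτ] at h2
  simp only [Function.comp_apply, hτ]
  calc ‖djQuot φ ⟨w, hw0⟩‖ ≤ 16 * ‖φ ⟨w, hw0⟩‖ * Real.exp (-(2 * Real.pi * w.im)) := h1
    _ ≤ 16 * (C * Real.exp (-(2 * Real.pi / h) * w.im)) * Real.exp (-(2 * Real.pi * w.im)) := by gcongr
    _ = _ := by ring

/-- Points of the closed unit disc about `z` have imaginary part `≥ im z − 1`. [folklore] -/
theorem sub_one_le_im_of_mem_closedBall {z w : ℂ} (hw : w ∈ closedBall z 1) : z.im - 1 ≤ w.im := by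
  have h1 : |(w - z).im| ≤ ‖w - z‖ := Complex.abs_im_le_norm _
  rw [mem_closedBall, dist_eq_norm] at hw
  rw [Complex.sub_im] at h1
  have := neg_abs_le (w.im - z.im)
  linarith

/-- **Cauchy estimate for `F'` at the cusp**: `‖F'(z)‖ ≤ C' e^{−(2π/h) im z} e^{−2π im z}` for `im z ≥ 3`.
[folklore] -/
theorem exists_norm_deriv_djQuot_ofComplex_le (hφ : IsCuspFunction h φ) :
    ∃ C, 0 ≤ C ∧ ∀ z : ℂ, 3 ≤ z.im → ‖deriv (djQuot φ ∘ ofComplex) z‖ ≤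
      C * Real.exp (-(2 * Real.pi / h) * z.im) * Real.exp (-(2 * Real.pi * z.im)) := by
  obtain ⟨C, hC0, hC⟩ := exists_norm_djQuot_ofComplex_le hφ
  have hh := hφ.pos
  refine ⟨16 * C * Real.exp (2 * Real.pi / h) * Real.exp (2 * Real.pi), by positivity, fun z hz => ?_⟩
  set F := djQuot φ ∘ ofComplex with hF
  have hd : DiffContOnCl ℂ F (ball z 1) := by
    refine DifferentiableOn.diffContOnCl ?_
    rw [closure_ball z one_ne_zero]
    intro w hw
    exact (differentiableAt_djQuot_of_two_le_im hφ.mdifferentiable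
      (by linarith [sub_one_le_im_of_mem_closedBall hw])).differentiableWithinAt
  have hbound : ∀ w ∈ sphere z 1, ‖F w‖ ≤ 16 * C * Real.exp (-(2 * Real.pi / h) * (z.im - 1)) *
      Real.exp (-(2 * Real.pi * (z.im - 1))) := by
    intro w hw
    have hwim := sub_one_le_im_of_mem_closedBall (sphere_subset_closedBall hw)
    have hw2 : 2 ≤ w.im := by linarith
    refine (hC w hw2).trans ?_
    have hc : 0 < 2 * Real.pi / h := by positivity
    have hπ := Real.pi_pos
    have e1 : Real.exp (-(2 * Real.pi / h) * w.im) ≤ Real.exp (-(2 * Real.pi / h) * (z.im - 1)) :=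
      Real.exp_le_exp.mpr (by nlinarith)
    have e2 : Real.exp (-(2 * Real.pi * w.im)) ≤ Real.exp (-(2 * Real.pi * (z.im - 1))) :=
      Real.exp_le_exp.mpr (by nlinarith)
    exact mul_le_mul (mul_le_mul_of_nonneg_left e1 (by positivity)) e2 (by positivity) (by positivity)
  have hest := Complex.norm_deriv_le_of_forall_mem_sphere_norm_le one_pos hd hbound
  rw [div_one] at hest
  refine hest.trans (le_of_eq ?_)
  have e1 : Real.exp (-(2 * Real.pi / h) * (z.im - 1)) =
      Real.exp (2 * Real.pi / h) * Real.exp (-(2 * Real.pi / h) * z.im) := by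
    rw [← Real.exp_add]; congr 1; ring
  have e2 : Real.exp (-(2 * Real.pi * (z.im - 1))) = Real.exp (2 * Real.pi) * Real.exp (-(2 * Real.pi * z.im)) := by
    rw [← Real.exp_add]; congr 1; ring
  rw [e1, e2]; ring

/-- **The Jacobian integrand at the cusp**: `‖J'(z)‖ · ‖F'(z)‖ ≤ C e^{−(2π/h) im z}` for `im z ≥ 3`. [folklore] -/
theorem exists_norm_deriv_mul_le_cusp (hφ : IsCuspFunction h φ) :
    ∃ C, ∀ z : ℂ, 3 ≤ z.im →
      ‖deriv (kleinJ ∘ ofComplex) z‖ * ‖deriv (djQuot φ ∘ ofComplex) z‖ ≤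
        C * Real.exp (-(2 * Real.pi / h) * z.im) := by
  obtain ⟨C, hC0, hC⟩ := exists_norm_deriv_djQuot_ofComplex_le hφ
  refine ⟨32 * Real.pi * C, fun z hz => ?_⟩
  have hz0 : 0 < z.im := by linarith
  have hJ := norm_deriv_kleinJ_le_of_two_le_im (z := ⟨z, hz0⟩) (show (2 : ℝ) ≤ z.im by linarith)
  change ‖deriv (kleinJ ∘ ofComplex) z‖ ≤ 32 * Real.pi * Real.exp (2 * Real.pi * z.im) at hJ
  have hπ := Real.pi_pos
  calc ‖deriv (kleinJ ∘ ofComplex) z‖ * ‖deriv (djQuot φ ∘ ofComplex) z‖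
      ≤ (32 * Real.pi * Real.exp (2 * Real.pi * z.im)) *
        (C * Real.exp (-(2 * Real.pi / h) * z.im) * Real.exp (-(2 * Real.pi * z.im))) :=
        mul_le_mul hJ (hC z hz) (norm_nonneg _) (by positivity)
    _ = 32 * Real.pi * C * Real.exp (-(2 * Real.pi / h) * z.im) := by
        rw [Real.exp_neg (2 * Real.pi * z.im)]
        field_simp

end CuspBound


end Summit.KontsevichZagierPeriods.HeckeMultiplicityOne.ManinStokes
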